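import Summits.AtomisticToContinuum.Crystallization.Theses.PerronTransitivity
import Summits.AtomisticToContinuum.Crystallization.Theorems.UniformBindingRigidity.Negative.LoadBearing
import Summits.AtomisticToContinuum.Crystallization.Theorems.UniformBindingRigidity.Negative.PeriodicCeiling
import Summits.AtomisticToContinuum.Crystallization.Theorems.UniformBindingRigidity.Negative.MinimaxFloor
import Summits.AtomisticToContinuum.Crystallization.Theorems.UniformBindingRigidity.Negative.LocallyFinite
import Summits.AtomisticToContinuum.Crystallization.Theorems.UniformBindingRigidity.Negative.SparseSuperBinding
import Summits.AtomisticToContinuum.Crystallization.Theorems.UniformBindingRigidity.Negative.DepthZero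
import Summits.AtomisticToContinuum.Crystallization.Theorems.UniformBindingRigidity.Negative.LocalRadius
import Summits.AtomisticToContinuum.Crystallization.Theorems.UniformBindingRigidity.Negative.LocalRadius13
import Summits.AtomisticToContinuum.Crystallization.Theorems.PerronTransitivityUniformBindingRigidityCohesionA
import Summits.AtomisticToContinuum.Crystallization.Theorems.PerronTransitivityUniformBindingRigidityCohesionD
import Summits.AtomisticToContinuum.Crystallization.Theorems.PerronTransitivityUniformBindingRigidityCohesionF
import Summits.AtomisticToContinuum.Crystallization.Theorems.PerronTransitivityUniformBindingRigidityPeriodicLeast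

/-!
# Disproof of `UniformBindingRigidity` (M*, crux stmt-AtomisticToContinuum-15099) — findings

Standing disprover's work file (seat `refuter-cdisprove-stmt-AtomisticToContinuum-15099-0`, cycle 1,
2026-08-17; **v4, gen 2** (`…-g2-0`, 2026-08-17): §6 added — line `registered` rev 5, the local certificate
`(LOCAL)` and its certificate radius; landed `Negative/LocalRadius.lean` p172796: `(LOCAL)` is FALSE at
radius `5/4`).  The crux, verbatim the route decl
`Summit.AtomisticToContinuum.Crystallization.Theses.PerronTransitivity.UniformBindingRigidity`:

  `∀ X ⊆ ℝ³, X.Nonempty → (X uniformly discrete) → (∀ p ∈ X, U_X(p) ≤ 2E*) →`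
  `∃ P periodic, P.points = X ∧ IsLeast (range e_LJ) (e_LJ P)`,

`U_X(p) = ∑'_{q ∈ X, q ≠ p} V_LJ(dist p q)`, `E* = ⨅_Q e_LJ(Q)` (`= eStar`, a genuine infimum and the
thermodynamic limit `lim E(N)/N`, tree `crysEnergyLimit`, axioms standard).

## Verdict of this cycle: NO KILL.  Why M* resists every cheap attack

1. **Elaboration / junk** (§0): rc 0; the body is `rfl`-equal to the displayed formula; no coercion
   traps; the `tsum` junk value `0` cannot enter (a non-summable site has `∑' = 0 > 2E*` since
   `2E* ≤ −1.435 < 0`, landed `LoadBearing.not_bound_of_not_summable`); the `⨅` is genuine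
   (`bddBelow_energyPerParticle_lennardJones`).
2. **The certification barrier** (§3, `periodic_lower_bound_of_bound_site`): the hypothesis
   `U_X(p) ≤ 2E*` at ONE site of ONE explicit `X` is equivalent to the lower bound
   `e_LJ(Q) ≥ U_X(p)/2` for EVERY periodic configuration `Q` of `ℝ³`.  Every candidate witness
   (aperiodic Barlow stackings, Frank–Kasper phases, quasicrystal approximants, decorated surfaces) has
   its sites within `10⁻⁴ … 10⁻¹` of `2e_hcp* = −1.43517963`, so certifying it in `H` needs a lower bound
   on the Lennard-Jones periodic ground-state energy sharp to `10⁻⁴` — the open Kepler-type half of the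
   crystal problem (Blanc–Lewin 2015 §2.3).  The tree's certified bounds are one-sided:
   `2E* ≤ −1.435` (upper).  Hence NO unconditional refutation of M* (or of the line's stubs, which share
   the conclusion shape `… < U_Y(p)`) is possible without first solving that half; conversely M* cannot
   be shown vacuous either (`H ≠ ∅` needs the same bound, or `TransitiveLocalLimit`).
3. **Numerics** (kit jobs j024255 smoke / the full run, folder `compute/minimax_binding.py`; units
   `V = r⁻¹²/12 − r⁻⁶/6`): relaxed hcp `a* = 0.971281`, `c/a = 1.632763`, `e_hcp* = −0.71758981`,
   `L* = 2|e_hcp*| = 1.43517963`.  WORST-site binding / `L*` at each structure's own best (minimax) scale: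
   hcp 1 (exact), fcc 0.999898, dhcp 0.999899 (its other half of sites at 0.9999999), bcc 0.956592,
   σ (dof relaxed) 0.901, A15 0.851, C14 0.776, C15 0.772, sh 0.790, sc 0.661, diamond 0.376; best
   single SITES: σ 0.9917, C14 0.969, A15 0.961 — every known non-hcp structure has a site under-bound by
   ≥ 1.0·10⁻⁴ (Barlow) resp. ≥ 4.3·10⁻² (non-Barlow, best = bcc); the random periodic-cell minimax
   search (n ≤ 8 atoms/cell) is reported in the Numerics docstring below when the full job returns.
   So there is no numerical counterexample to hunt with certified numerics either: the margin to beat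
   is zero and every candidate is on the wrong side of it.
4. **Structural facts that ARE provable** and that the provers can use (§1–§4 below, all
   sorry-free unless marked): the periodic case is a tautology (landed `stub_periodicLeast`,
   `PeriodicCeiling`); the `IsLeast` conjunct is automatic (`crux_iff_periodic`); members of `H` are
   infinite, unbounded and meet both sides of every slab (landed cohesion helpers, repackaged in §2);
   the binding hypothesis ALONE already forces local finiteness (§2, `finite_inter_closedBall_of_bound`,
   NEW, landed as `Negative/LocallyFinite.lean` p151509) — so hypothesis (2) "uniformly discrete" is at
   least half redundant (mutation finding; full
   redundancy = "binding ⇒ uniformly discrete" is open, conjectured true, and no counterexample can be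
   certified for the reason in item 2).
5. **Load-bearing hypotheses** (§1): `X.Nonempty` and the binding hypothesis are each necessary
   (landed `LoadBearing`); the LEVEL `2E*` is load-bearing in the strong sense that it cannot be
   LOWERED at all: below `2E*` the hypothesis class is EMPTY for every uniformly discrete `X`
   (global minimax floor, §4 — the main new negative lemma of this cycle, LANDED as
   `Theorems/UniformBindingRigidity/Negative/MinimaxFloor.lean`, p150752; its companion
   `Negative/SparseSuperBinding.lean`, p151706, shows that INSIDE `H` strictly super-bound sites have
   density zero — zero slack for arbitrary members, not only periodic ones), and it cannot be RAISED by any `ε > 0` without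
   admitting fcc/dhcp-type stackings numerically (`|J₂| ≈ 7.3·10⁻⁵`, uncertifiable for the reason in 2).

6. **What the positive side really is** (for the provers): with the stacking lock landed, the open
   stub `stub_barlowChart` ("relatively dense + uniformly `2E*`-bound ⇒ rigid image of a Barlow stacking")
   is a SOFT-POTENTIAL version of Fejes Tóth's twelve-neighbour conjecture — "a packing of unit balls in
   which every ball touches twelve others is a Barlow (hexagonal-layer) packing" — proved by Hales only in
   2012 with Flyspeck-type machinery (arXiv:1209.6043, the crux's source `Hales2012`); for the sticky
   potential that theorem plus the `ShortRangeStackingBlindness` barrier shows the analogue of M* is FALSE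
   (aperiodic Barlow stackings are uniformly bound), and Lennard-Jones escapes only through `J₂ ≠ 0`.  So
   M* = (LJ-soft Fejes Tóth rigidity) + (landed lock); a disprover cannot undercut the first factor with
   finite information, and §5 records the one structural way M* could still fail to be USEFUL (empty `H`).

## Line `registered` (Lines/birth.lean rev 2) — stub attack summary (`-- Targets`)
* `stub_noThickHalfSpaceBinding` (NHB-thick) and `stub_barlowChart` both conclude with a STRICT
  lower bound `2E* < U_Y(p)` at some site / a chart for members of `H`; refuting either needs a `Y`
  certified INSIDE the uniformly-bound class — the certification barrier of item 2 applies verbatim.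
  Junk cannot help the refuter (a non-summable site makes the stub's conclusion TRUE).  No stub is
  false for a degenerate reason: `Y = {0}` / finite `Y` / slabs are excluded or settled by the landed
  `noSlabBinding`; the (a,h)-box of `stub_barlowChart` contains the relaxed hcp optimum
  (`a* = 0.9713 ∈ [0.94, 1]`, `h*/a* = 0.8164 ∈ [0.78, 0.85]`, job j024255).
* Joint sufficiency: `UniformBindingRigidity_of` is kernel-checked from the two stubs (registrar);
  nothing is smuggled — the composition only uses landed theorems.
* Single-site versions of (NHB-thick) are FALSE numerically (lead c1/c2: a `0.775`-separated
  half-space configuration binds the boundary site at `−1.43 ≈ 2E*`; with the stub's `1/4` separation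
  the boundary site alone can be bound far below `2E*` by crowding its hemisphere) — but again not
  certifiable as a Lean refutation of the single-site strengthening without the lower bound on `E*`,
  except in the grossly crowded regime where the crude stability bound would do; not pursued (the
  multi-site stub is the one registered).
-/

noncomputable section

namespace Summit.AtomisticToContinuum.Crystallization.Cruxes.UniformBindingRigidity.Disproof

open scoped BigOperators Topology
open Filter Set Metric
open Literature.MathematicalPhysics.StatisticalMechanics
open Summit.AtomisticToContinuum.Crystallization.Theses.PerronTransitivity (UniformBindingRigidity)
open Summit.AtomisticToContinuum.Crystallization.Theorems.ChargedEnergyGapNegative (E3 eStar eStar_le)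
open Summit.AtomisticToContinuum.Crystallization.Theorems.PerronTransitivityUniformBindingRigidity
  (quarter_le_dist two_mul_iInf_lt_zero finite_sep_ball noSlabBinding tsum_site_sub_const
    stub_periodicLeast)
open Summit.AtomisticToContinuum.Crystallization.Theorems.UniformBindingRigidity.Negative

/-! ## §0 Vocabulary (definitionally the crux's own sub-expressions) -/

/-- The Lennard-Jones site sum `U_X(p) = ∑'_{q ∈ X, q ≠ p} V_LJ(dist p q)`. -/
def U (X : Set E3) (p : E3) : ℝ :=
  ∑' q : {q : E3 // q ∈ X ∧ q ≠ p}, lennardJones (dist p q.1)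

/-- The level `2E* = 2 ⨅_Q e_LJ(Q)` of the crux. -/
def level : ℝ := 2 * ⨅ Q : PeriodicConfiguration 3, Q.energyPerParticle lennardJones

/-- Hypothesis (2) of the crux: `X` is uniformly discrete. -/
def UniformlyDiscrete (X : Set E3) : Prop :=
  ∃ δ : ℝ, 0 < δ ∧ ∀ p ∈ X, ∀ q ∈ X, p ≠ q → δ ≤ dist p q

/-- Hypothesis (3) of the crux: every site of `X` is bound at least as well as the crystal average. -/
def Bound (X : Set E3) : Prop := ∀ p ∈ X, U X p ≤ level

/-- Conclusion of the crux: `X` is the point set of a periodic minimiser. -/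
def IsMinimiserPoints (X : Set E3) : Prop :=
  ∃ P : PeriodicConfiguration 3, P.points = X ∧
    IsLeast (Set.range fun Q : PeriodicConfiguration 3 => Q.energyPerParticle lennardJones)
      (P.energyPerParticle lennardJones)

/-- The crux in this vocabulary (definitional). -/
theorem crux_iff :
    UniformBindingRigidity ↔ ∀ X : Set E3, X.Nonempty → UniformlyDiscrete X → Bound X →
      IsMinimiserPoints X := Iff.rfl

/-- `level = 2 e*`. -/
theorem level_eq : level = 2 * eStar := rfl

/-- `level < 0` (tree: `2E* ≤ −711/500`). -/
theorem level_lt_zero : level < 0 := two_mul_iInf_lt_zero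

/-! ## §1 Load-bearing hypotheses (landed `Negative/LoadBearing.lean`, p146049; restated) -/

/-- Any proof must use `X.Nonempty` (witness `X = ∅`). [folklore] -/
theorem false_without_nonempty :
    ¬ ∀ X : Set E3, UniformlyDiscrete X → Bound X → IsMinimiserPoints X :=
  LoadBearing.false_without_nonempty

/-- Any proof must use the binding hypothesis (witness `X = {0}`). [folklore] -/
theorem false_without_bound :
    ¬ ∀ X : Set E3, X.Nonempty → UniformlyDiscrete X → IsMinimiserPoints X :=
  LoadBearing.false_without_binding

/-! ## §2 Excluded witness classes (all unconditional)

(a) periodic `X`: the crux is TRUE there (landed `stub_periodicLeast`; zero slack `PeriodicCeiling`);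
(b) the `IsLeast` conjunct is automatic, so a counterexample must be a NON-PERIODIC member of `H`;
(c) members of `H` are `1/4`-separated, infinite, unbounded, and not contained in any slab;
(d) NEW: the binding hypothesis alone forces local finiteness (no accumulation point). -/

/-- **(a)+(b) The crux is equivalent to its `IsLeast`-free form**: a uniformly bound periodic
configuration is automatically a least element (landed `stub_periodicLeast`). [folklore] -/
theorem crux_iff_periodic :
    UniformBindingRigidity ↔ ∀ X : Set E3, X.Nonempty → UniformlyDiscrete X → Bound X →
      ∃ P : PeriodicConfiguration 3, P.points = X := by
  refine ⟨fun h X hne hud hB => ?_, fun h X hne hud hB => ?_⟩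
  · obtain ⟨P, hP, -⟩ := h X hne hud hB
    exact ⟨P, hP⟩
  · obtain ⟨P, hP⟩ := h X hne hud hB
    exact ⟨P, hP, stub_periodicLeast P (hP ▸ hB)⟩

/-- **(c₁) Members of `H` are `1/4`-separated** whatever their own `δ` (landed `quarter_le_dist`). [folklore] -/
theorem quarter_sep_of_bound {X : Set E3} (hud : UniformlyDiscrete X) (hB : Bound X) :
    ∀ p ∈ X, ∀ q ∈ X, p ≠ q → 1 / 4 ≤ dist p q :=
  quarter_le_dist hud fun p hp => (hB p hp).trans level_lt_zero.le

/-- **(c₂) No member of `H` lies in a slab** `{−T ≤ ⟪q − c, u⟫ ≤ 0}` through one of its points `c`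
(landed `noSlabBinding`, translated by `c`). [folklore] -/
theorem not_bound_of_slab {X : Set E3} (hud : UniformlyDiscrete X) {c : E3} (hc : c ∈ X)
    {u : E3} (hu : ‖u‖ = 1) {T : ℝ} (hslab : ∀ q ∈ X, -T ≤ inner ℝ (q - c) u ∧ inner ℝ (q - c) u ≤ 0) :
    ¬ Bound X := by
  intro hB
  have hsep := quarter_sep_of_bound hud hB
  set Y : Set E3 := (fun z => z - c) '' X with hY
  have h0 : (0 : E3) ∈ Y := ⟨c, hc, sub_self c⟩
  have hsepY : ∀ p ∈ Y, ∀ q ∈ Y, p ≠ q → 1 / 4 ≤ dist p q := by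
    rintro _ ⟨p, hp, rfl⟩ _ ⟨q, hq, rfl⟩ hpq
    rw [dist_sub_right]
    exact hsep p hp q hq fun h => hpq (by rw [h])
  have hslabY : ∀ q ∈ Y, -T ≤ inner ℝ q u ∧ inner ℝ q u ≤ 0 := by
    rintro _ ⟨q, hq, rfl⟩
    exact hslab q hq
  obtain ⟨_, ⟨p, hp, rfl⟩, hlt⟩ := noSlabBinding hu h0 hsepY hslabY
  rw [hY, tsum_site_sub_const X c p] at hlt
  exact absurd (hB p hp) (not_le.2 hlt)

/-- **(c₃) No FINITE set is uniformly bound**: a finite non-empty `X` has a site with `U_X(p) > 2E*`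
(it lies in a slab through a point maximising a linear functional).  Hence M* — whose conclusion fails
on every finite set — is consistent there, and a counterexample must be infinite. [folklore] -/
theorem not_bound_of_finite {X : Set E3} (hfin : X.Finite) (hne : X.Nonempty) : ¬ Bound X := by
  classical
  -- a unit vector and a point of `X` maximising `⟪·, u⟫`
  obtain ⟨u, hu1⟩ : ∃ u : E3, ‖u‖ = 1 := exists_norm_eq E3 zero_le_one
  have hneF : hfin.toFinset.Nonempty := by simpa using hne
  obtain ⟨c, hc, hmax⟩ := hfin.toFinset.exists_max_image (fun q => inner ℝ q u) hneF
  rw [Set.Finite.mem_toFinset] at hc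
  -- a bound on the norms
  obtain ⟨M, hM⟩ := (hfin.image fun q : E3 => ‖q‖).bddAbove
  -- uniformly discrete: finite sets are
  have hud : UniformlyDiscrete X := by
    by_cases hsub : X.Subsingleton
    · exact ⟨1, one_pos, fun p hp q hq hpq => (hpq (hsub hp hq)).elim⟩
    · rw [Set.not_subsingleton_iff] at hsub
      exact ⟨X.infsep, (hfin.infsep_pos_iff_nontrivial).2 hsub,
        fun p hp q hq hpq => Set.infsep_le_dist_of_mem hp hq hpq⟩
  refine not_bound_of_slab hud hc hu1 (T := M + ‖c‖) fun q hq => ⟨?_, ?_⟩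
  · have h1 : |inner ℝ (q - c) u| ≤ ‖q - c‖ * ‖u‖ := abs_real_inner_le_norm _ _
    rw [hu1, mul_one] at h1
    have h2 : ‖q - c‖ ≤ ‖q‖ + ‖c‖ := norm_sub_le q c
    have h3 : ‖q‖ ≤ M := hM ⟨q, hq, rfl⟩
    have := neg_abs_le (inner ℝ (q - c) u)
    linarith
  · rw [inner_sub_left, sub_nonpos]
    exact hmax q (by simpa using hq)

/-- Hence **members of `H` are infinite** … [folklore] -/
theorem infinite_of_bound {X : Set E3} (hne : X.Nonempty) (hB : Bound X) : X.Infinite :=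
  fun hfin => not_bound_of_finite hfin hne hB

/-- … and **unbounded** (a bounded uniformly discrete set is finite). [folklore] -/
theorem not_isBounded_of_bound {X : Set E3} (hne : X.Nonempty) (hud : UniformlyDiscrete X)
    (hB : Bound X) : ¬ Bornology.IsBounded X := by
  intro hbdd
  obtain ⟨δ, hδ, hsep⟩ := hud
  obtain ⟨R, hR⟩ := hbdd.subset_closedBall 0
  refine infinite_of_bound hne hB ((finite_sep_ball hδ hsep 0 R).subset fun q hq => ⟨hq, ?_⟩)
  exact mem_closedBall.1 (hR hq)

/-! ### (d) The binding hypothesis alone forces local finiteness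

Mutation of hypothesis (2).  Dropping "uniformly discrete" does NOT open the door to wild witnesses
with accumulation points: at a point `p ∈ X` near an accumulation point `z` of `X` (with
`0 < dist p z < 2^{-1/6}`) infinitely many terms of the site family are close to `V_LJ(dist p z) > 0`,
so the family is not summable, its `tsum` is the junk `0 > 2E*`, and the binding hypothesis fails
at `p`.  So `Bound X` already implies that `X` is locally finite; whether it implies UNIFORM
discreteness (full redundancy of hypothesis (2)) is open — a counterexample would again have to be
certified inside `H` (item 2 of the header). -/

/-- **Binding forces local finiteness** (LANDED as `Negative/LocallyFinite.lean`, p151509): if every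
site of `X ⊆ ℝ³` satisfies the binding inequality of the crux, then `X` meets every closed ball in a
finite set — WITHOUT assuming hypothesis (2). [folklore] -/
theorem finite_inter_closedBall_of_bound {X : Set E3} (hB : Bound X) (c : E3) (R : ℝ) :
    (X ∩ closedBall c R).Finite :=
  LocallyFinite.finite_inter_closedBall_of_bound hB c R

/-- Corollary: under the binding hypothesis alone, `X` is countable and locally finite; stated as:
every bounded subset of `X` is finite. [folklore] -/
theorem finite_of_bound_of_isBounded {X : Set E3} (hB : Bound X) {S : Set E3} (hS : S ⊆ X)
    (hbdd : Bornology.IsBounded S) : S.Finite := by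
  obtain ⟨R, hR⟩ := hbdd.subset_closedBall 0
  exact (finite_inter_closedBall_of_bound hB 0 R).subset fun q hq => ⟨hS hq, hR hq⟩

/-! ## §3 The certification barrier, made formal

A single certified member of `H` — indeed a single certified bound SITE — is a lower bound on the
energy per particle of EVERY periodic configuration of `ℝ³`.  This is why no explicit witness can be
filed: all candidates sit within `10⁻⁴…10⁻¹` of the presumed optimum (header, item 3), and lower
bounds on the Lennard-Jones periodic ground-state energy of that quality are the open half of the
crystal problem. -/

/-- **A bound site bounds every periodic energy from below**: `U_X(p) ≤ 2E*` gives
`U_X(p)/2 ≤ e_LJ(Q)` for all periodic `Q`. [folklore] -/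
theorem periodic_lower_bound_of_bound_site {X : Set E3} {p : E3} (h : U X p ≤ level)
    (Q : PeriodicConfiguration 3) : U X p / 2 ≤ Q.energyPerParticle lennardJones := by
  have hQ : eStar ≤ Q.energyPerParticle lennardJones := eStar_le Q
  rw [level_eq] at h
  linarith

/-- Conversely the hypothesis class is sandwiched by the certified UPPER bounds only:
what the tree knows is `level ≤ −1.422` (`two_mul_iInf_le`, via fcc at `√(19/20)`), i.e. every member
of `H` has all sites `≤ −1.422`; nothing bounds `level` from below by an explicit constant near
`−1.4352`. [folklore] -/
theorem bound_le_of_bound {X : Set E3} (hB : Bound X) {p : E3} (hp : p ∈ X) :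
    U X p ≤ -(711 / 500) :=
  (hB p hp).trans Theorems.PerronTransitivityUniformBindingRigidity.two_mul_iInf_le

/-! ## §4 Tightness of the level: the global minimax floor (main negative lemma of this cycle)

`MinimaxFloor`: for EVERY non-empty uniformly discrete `X ⊆ ℝ³`, `sup_p U_X(p) ≥ 2E*`; i.e. the
variant of the crux with the level `2E*` replaced by any `ℓ < 2E*` is VACUOUSLY true (its hypothesis
class is empty), and `H` is exactly the set of minimisers of the minimax functional
`X ↦ sup_{p ∈ X} U_X(p)` over all uniformly discrete sets, IF its value `2E*` is attained at all.
This generalises the landed periodic ceiling (`PeriodicCeiling.exists_site_ge`) from periodic to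
arbitrary `X`.  Proof (being formalised in `Negative/MinimaxFloor.lean`, this cycle): if all sites
were `≤ 2E* − ε`, then for every finite `F ⊆ X`, `|F|·E* ≤ E_LJ(F)` (tree `card_mul_eStar_le`,
periodisation) and `2E_LJ(F) = Σ_{p∈F} U_X(p) − (cross terms) ≤ |F|(2E* − ε) + (1/6)·cut₆(F)` give
`6ε|F| ≤ cut₆(F) := Σ_{p ∈ F} Σ'_{q ∈ X∖F} dist(p,q)⁻⁶`; for balls `F_R = X ∩ B̄(0,R)` the dyadic
tail bound `Σ_{dist ≥ t} dist⁻⁶ ≤ 65536/t³` (`1/4`-separation) summed over integer radii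
`R ∈ [R₁, 2R₁)` gives `ε R₁ N(R₁) ≤ C·N(2R₁)`, hence `N(2R) ≥ 16 N(R)` for all large `R`, against the
cubic packing bound `N(R) ≤ (8R+1)³` — contradiction (in the landed file the sum over radii is
replaced by the simpler two-radius split `ε N(R) ≤ (ε/2)N(R) + W(N(R) − N(R−T))`, giving geometric
inward decay `N(R−T) ≤ θ N(R)` against cubic growth).  LANDED: p150752, commit e5fb73d2b179,
`Theorems/UniformBindingRigidity/Negative/MinimaxFloor.lean` (`exists_site_gt_of_lt`,
`not_uniformly_bound_below`, `lowered_level_vacuous`, `exists_site_gt_sub`). -/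

/-- **Minimax floor** (landed `Negative/MinimaxFloor.exists_site_gt_of_lt`, p150752): no non-empty
uniformly discrete `X ⊆ ℝ³` has all its Lennard-Jones site sums strictly below a level `ℓ < 2E*`.
Equivalently `∀ ε > 0, ∃ p ∈ X, 2E* − ε < U_X(p)`. [folklore] -/
theorem minimaxFloor (X : Set E3) (hne : X.Nonempty) (hud : UniformlyDiscrete X) {ℓ : ℝ}
    (hℓ : ℓ < level) : ∃ p ∈ X, ℓ < U X p :=
  MinimaxFloor.exists_site_gt_of_lt X hne hud hℓ

/-- Hence **the level of M* cannot be lowered**: with any `ℓ < 2E*` in place of `2E*` the crux is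
vacuously true (empty hypothesis class). [folklore] -/
theorem crux_vacuous_below_level {ℓ : ℝ} (hℓ : ℓ < level) :
    ∀ X : Set E3, X.Nonempty → UniformlyDiscrete X → (∀ p ∈ X, U X p ≤ ℓ) → IsMinimiserPoints X := by
  intro X hne hud hB
  obtain ⟨p, hp, hlt⟩ := minimaxFloor X hne hud hℓ
  exact absurd (hB p hp) (not_le.2 hlt)

/-- So the hypothesis class `H` of M* is exactly the set of MINIMISERS of the minimax functional
`X ↦ sup_p U_X(p)` over non-empty uniformly discrete sets, whose infimum is `≥ 2E*`: a member of `H`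
realises the floor. [folklore] -/
theorem floor_attained_of_bound {X : Set E3} (hne : X.Nonempty) (hud : UniformlyDiscrete X)
    (hB : Bound X) : (∀ p ∈ X, U X p ≤ level) ∧ ∀ ℓ < level, ∃ p ∈ X, ℓ < U X p :=
  ⟨hB, fun _ hℓ => minimaxFloor X hne hud hℓ⟩

/-- **Zero slack for arbitrary members of `H`: super-bound sites are sparse** (LANDED as
`Negative/SparseSuperBinding.lean`, p151706).  In a member of the hypothesis class, for every `η > 0`
the sites bound `≤ 2E* − η` have lower density zero along balls about `0`: for every `ε > 0` and `R₀`
some radius `R ≥ R₀` has at most `ε·#(X ∩ B̄(0,R))` of them.  (The periodic case is the landed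
`PeriodicCeiling.motif_site_eq_of_bound`: there EVERY site is bound at exactly `2E*`.)  So `H` is, up to
sparse defects, the class of exactly energy-transitive configurations `U_X ≡ 2E*` of the sibling crux
`TransitiveLocalLimit`, and no configuration with a positive density of strictly super-bound sites can
ever be a refutation witness. [folklore] -/
theorem sparse_superbound {X : Set E3} (hne : X.Nonempty) (hud : UniformlyDiscrete X) (hB : Bound X)
    {η : ℝ} (hη : 0 < η) {ε : ℝ} (hε : 0 < ε) (R₀ : ℝ) :
    ∃ R : ℝ, R₀ ≤ R ∧ ∀ (F S : Finset E3),
      (∀ a, a ∈ F ↔ a ∈ X ∧ dist a 0 ≤ R) →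
      (∀ a, a ∈ S ↔ (a ∈ X ∧ dist a 0 ≤ R) ∧ U X a ≤ level - η) →
      (S.card : ℝ) ≤ ε * F.card :=
  SparseSuperBinding.sparse_superbound X hne hud hB hη hε R₀

/-! ## §5 Is `H` empty?  Relations with the sibling crux `TransitiveLocalLimit` (stmt-15100)

M* could also hold for a SILLY reason: if no uniformly discrete set is uniformly bound at `2E*` at all
(`H = ∅` — e.g. if the Lennard-Jones periodic infimum is not attained, or attained only by
configurations with two inequivalent site classes straddling the mean, dhcp-like), the crux is
vacuously true and useless to the route (the assembly feeds it the transitive local limit).  The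
route's other crux `TransitiveLocalLimit` is precisely `H ≠ ∅` realised by a local limit of ground
states; the two cruxes together force `E*` to be ATTAINED.  Recorded for the planners. -/

/-- `H = ∅` makes M* vacuously true. [folklore] -/
theorem crux_of_hypothesisClass_empty
    (h : ¬ ∃ X : Set E3, X.Nonempty ∧ UniformlyDiscrete X ∧ Bound X) : UniformBindingRigidity :=
  fun X hne hud hB => (h ⟨X, hne, hud, hB⟩).elim

/-- `TransitiveLocalLimit` (crux stmt-15100) produces a member of `H` (ground states exist for every
`N`, tree `LennardJonesGroundStatesExist_holds`). [folklore] -/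
theorem hypothesisClass_nonempty_of_transitiveLocalLimit
    (hT : Summit.AtomisticToContinuum.Crystallization.Theses.PerronTransitivity.TransitiveLocalLimit) :
    ∃ X : Set E3, X.Nonempty ∧ UniformlyDiscrete X ∧ Bound X := by
  choose x hx using
    Literature.MathematicalPhysics.StatisticalMechanics.LennardJonesGroundStatesExist_holds
  obtain ⟨X, σ, τ, hne, hsep, -, -, hU⟩ := hT x hx
  exact ⟨X, hne, hsep, fun p hp => (hU p hp).le⟩

/-- Hence **the two cruxes of the route together force the periodic infimum `E*` to be attained**
(so a certified proof that `E*` is NOT attained would break the line, though neither crux alone).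
[folklore] -/
theorem attained_of_crux_of_transitiveLocalLimit (hM : UniformBindingRigidity)
    (hT : Summit.AtomisticToContinuum.Crystallization.Theses.PerronTransitivity.TransitiveLocalLimit) :
    ∃ P : PeriodicConfiguration 3,
      IsLeast (Set.range fun Q : PeriodicConfiguration 3 => Q.energyPerParticle lennardJones)
        (P.energyPerParticle lennardJones) := by
  obtain ⟨X, hne, hud, hB⟩ := hypothesisClass_nonempty_of_transitiveLocalLimit hT
  obtain ⟨P, -, hP⟩ := hM X hne hud hB
  exact ⟨P, hP⟩

/-- Contrapositive bookkeeping: if `E*` is not attained, M* holds iff `H = ∅`. [folklore] -/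
theorem crux_iff_hypothesisClass_empty_of_not_attained
    (hna : ¬ ∃ P : PeriodicConfiguration 3,
      IsLeast (Set.range fun Q : PeriodicConfiguration 3 => Q.energyPerParticle lennardJones)
        (P.energyPerParticle lennardJones)) :
    UniformBindingRigidity ↔ ¬ ∃ X : Set E3, X.Nonempty ∧ UniformlyDiscrete X ∧ Bound X := by
  refine ⟨fun hM ⟨X, hne, hud, hB⟩ => ?_, crux_of_hypothesisClass_empty⟩
  obtain ⟨P, -, hP⟩ := hM X hne hud hB
  exact hna ⟨P, hP⟩


/-! ## §6 Line `registered` rev 5 — the local certificate `(LOCAL)` and its certificate radius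
(gen 2, seat `refuter-cdisprove-stmt-AtomisticToContinuum-15099-g2-0`, 2026-08-17)

Rev 5 of `Lines/birth.lean` has ONE open `e*`-free stub, `stub_localHalfSpaceCert` `(LOCAL)` =
`LocalCert (23/40) (711/500) 6` below (`stub_localHalfSpaceCert_iff`, `Iff.rfl`): in a `23/40`-separated
configuration `Y ∋ 0` of the closed lower half-space some site `p` with `dist p 0 ≤ 6` has site sum
`> -711/500`.  (The other open stub `stub_barlowChart` carries `≤ 2E*` — certification barrier, §3.)
`LocalCert δ λ ρ` is monotone (`LocalCert.mono`): truth propagates to larger `δ, λ, ρ`, falsity to smaller.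
The lead asked (LEAD-c2) for cloud-type witnesses against `(LOCAL)` and hopes for a finite certificate
`FINCERT` at radius `2–3`.  The disprover's yardstick is the CERTIFICATE RADIUS `ρ`:

**The hollow core.**  `Y = {0} ∪ S` with `S ⊂ {z ≤ 0, |x| > ρ}` `δ`-separated: only the top site is
constrained, and `(LOCAL)_ρ` fails iff `F(ρ) := sup_S Σ_{s ∈ S} (−V_LJ |s|) ≥ λ` (`not_localCert_of_hollowCore`).
Rungs (separation `23/40`, `λ = 1.422`; `−V_LJ(r) = r⁻⁶/6 − r⁻¹²/12`, max `1/12` at `r = 1`):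
* `ρ = 0`: `F = ∞`-like (clouds); at separation `1/4` already `21` points at distance `1` give `7/4`
  (`Negative/DepthZero`, p168045; here `not_localCert_quarter`: `¬ LocalCert (1/4) λ ρ` for `ρ < 1`, `λ ≤ 7/4`).
* `ρ = 5/4`: **FALSE, LANDED** `Negative/LocalRadius.lean` (p172796, kernel-only): `104` points of
  `(1/1000)ℤ³` — hemispherical codes of `35` points at radius `≈ 1.2515` and `69` at `≈ 1.829`, pairwise
  squared grid distance `≥ 575²` (`decide +kernel`) — bind the top site at `≤ 35·V(1.252) + 69·V(1.83) ≤ −81/50`;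
  `localCert_false_of_radius_le : ρ ≤ 5/4 → λ ≤ 81/50 → ¬ LocalCert (23/40) λ ρ` (in the notation here).
* layered estimates (radial layer spacing exactly `23/40`, layers = max hemispherical codes found by
  relaxation; cdisprove folder `compute/local/fsea_layers.py`): `ρ = 1.25`: `n = 35/69/102` at
  `R = 1.251/1.826/2.401` → cumulative `1.323/1.629/1.718` (+ tail `≈ 0.10`); `ρ = 1.30`: `37/71/106` →
  `1.141/1.409/1.490` (+`0.10` → `1.59`; a kernel certificate at `ρ = 13/10` with `214` points and margin
  `≈ 0.05` is available on request); `ρ = 1.35`: `39/74/112` → `0.981/1.220/1.297` (+`0.09` → `1.39 < 1.422`;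
  needs 3-D packing of the second shell, margin then `≈ +0.05`, job j027919); `ρ = 1.40`: `≈ 1.33 < 1.422`.
  **`ρ_dead(hollow) ≈ 1.4`.**  Continuum tail rule: a `23/40`-separated sea beyond radius `R` adds at most
  `≈ 2πρ_max(R⁻³/18)`, `ρ_max = √2/δ³ ≈ 7.44`, i.e. `0.77 / 0.33 / 0.10 / 0.012` beyond `R = 1.5 / 2 / 3 / 6`.
* `ρ ∈ [1.4, ≈1.65]` — **CUP designs beat hollow cores** (gen 2, local pure-python model, kit jobs
  j028083–5 pending): constrained sites = `0` and a FIRST SHELL of `k = 10–12` sites `c` at `|c| ≈ 1.0–1.07`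
  (mutual distances `0.83–0.90`, four of them in the plane `z = 0`), every `c` bound at `1.49–1.60` by a dense
  `23/40`-sea kept `≥ 0.82` from the shell and `≥ ρ` from `0`; the top site collects `k/12 ≈ 0.83–0.9` from the
  shell and `≈ 0.55 + 0.08 (tail)` from the sea.  Numbers at `ρ = 1.5` (explicit sea to radius `3.1–3.2`, tail
  beyond NOT included, worth `≈ +0.06–0.08`): cup9 `1.363–1.383`, cup10 `1.383`, **cup11 `1.4215`**, onion-14
  `1.401`; all shell sites `≥ 1.49`; so `sup min-binding ≈ 1.48–1.50 > 1.422`: **`(LOCAL)` is numerically FALSE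
  at certificate radius `1.5`** (certification in preparation: exact grid witness with explicit sea to `3.6`,
  per-site binned bounds).  `ρ = 1.4`: cup9 `1.366` (+tail); `ρ = 1.6`: cup9 `1.299` (+tail `0.08` → `1.38`),
  larger `k` pending.  Mechanism limit: the shell needs the sea within `≈ 0.95` of it and the top site needs the
  sea band `1.5–2.0` (worth `≈ 0.3`); expected `ρ_dead(cup) ≈ 1.6–1.7`; at `ρ = 2` onion variants are estimated
  at `≈ 1.2–1.3 < 1.422` (first shell `≤ 11/12`, one-sided kissing number `B(3) = 9` at chord `1`
  [G. Fejes Tóth 1981; Musin, arXiv:math/0511071, p. 3] caps the unit-distance shell; a viable second shell is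
  worth `≈ 0.15–0.2`, the sea beyond `2` `≈ 0.2–0.3`).
* CONSEQUENCE FOR THE LEAD: a `FINCERT` must have radius `≥ ≈ 1.7`, and its worst branch is NOT the hollow core
  but cup configurations — a crowded, mutually repulsive but individually viable first shell fed by an
  unconstrained dense exterior; at radius `2` the expected margin is only `≈ 0.1–0.2` out of `1.422`, at radius
  `3` the exterior is worth `≤ 0.10` to the top site and `≈ 0.3–0.6` to sites `1` inside the boundary.  The
  top site alone is NOT a valid pivot below radius `≈ 1.7`.
-/

/-- `(LOCAL)` with parameters: separation `δ`, level `-lam`, certificate radius `ρ`. [folklore] -/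
def LocalCert (δ lam ρ : ℝ) : Prop :=
  ∀ (Y : Set (EuclideanSpace ℝ (Fin 3))) (u : EuclideanSpace ℝ (Fin 3)), ‖u‖ = 1 →
    (0 : EuclideanSpace ℝ (Fin 3)) ∈ Y →
    (∀ p ∈ Y, ∀ q ∈ Y, p ≠ q → δ ≤ dist p q) →
    (∀ q ∈ Y, inner ℝ q u ≤ 0) →
    (∀ p ∈ Y, dist p 0 ≤ ρ → ∑' q : {q : EuclideanSpace ℝ (Fin 3) // q ∈ Y ∧ q ≠ p},
        lennardJones (dist p q.1) ≤ -lam) →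
    False

/-- The registered stub `stub_localHalfSpaceCert` is `LocalCert (23/40) (711/500) 6`, verbatim. [folklore] -/
theorem stub_localHalfSpaceCert_iff :
    LocalCert (23 / 40) (711 / 500) 6 ↔
      ∀ (Y : Set (EuclideanSpace ℝ (Fin 3))) (u : EuclideanSpace ℝ (Fin 3)), ‖u‖ = 1 →
        (0 : EuclideanSpace ℝ (Fin 3)) ∈ Y →
        (∀ p ∈ Y, ∀ q ∈ Y, p ≠ q → 23 / 40 ≤ dist p q) →
        (∀ q ∈ Y, inner ℝ q u ≤ 0) →
        (∀ p ∈ Y, dist p 0 ≤ 6 → ∑' q : {q : EuclideanSpace ℝ (Fin 3) // q ∈ Y ∧ q ≠ p},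
            lennardJones (dist p q.1) ≤ -(711 / 500)) →
        False :=
  Iff.rfl

/-- Monotonicity of `(LOCAL)`: truth propagates to larger separation, level parameter and radius. [folklore] -/
theorem LocalCert.mono {δ δ' lam lam' ρ ρ' : ℝ} (hδ : δ ≤ δ') (hlam : lam ≤ lam') (hρ : ρ ≤ ρ') :
    LocalCert δ lam ρ → LocalCert δ' lam' ρ' := by
  intro h Y u hu h0 hsep hhalf hU
  refine h Y u hu h0 (fun p hp q hq hpq => hδ.trans (hsep p hp q hq hpq)) hhalf ?_
  intro p hp hpρ
  exact (hU p hp (hpρ.trans hρ)).trans (by linarith)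

/-- … so falsity propagates to smaller parameters. [folklore] -/
theorem not_localCert_anti {δ δ' lam lam' ρ ρ' : ℝ} (hδ : δ ≤ δ') (hlam : lam ≤ lam') (hρ : ρ ≤ ρ')
    (h : ¬ LocalCert δ' lam' ρ') : ¬ LocalCert δ lam ρ :=
  fun h' => h (h'.mono hδ hlam hρ)

/-- **The hollow-core criterion**: a `δ`-separated half-space configuration through `0` with no other
site within `ρ` of `0` and top site bound at `≤ -lam` refutes `LocalCert δ lam ρ`. [folklore] -/
theorem not_localCert_of_hollowCore {δ lam ρ : ℝ}
    (h : ∃ (Y : Set (EuclideanSpace ℝ (Fin 3))) (u : EuclideanSpace ℝ (Fin 3)), ‖u‖ = 1 ∧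
      (0 : EuclideanSpace ℝ (Fin 3)) ∈ Y ∧ (∀ p ∈ Y, ∀ q ∈ Y, p ≠ q → δ ≤ dist p q) ∧
      (∀ q ∈ Y, inner ℝ q u ≤ 0) ∧ (∀ p ∈ Y, dist p 0 ≤ ρ → p = 0) ∧
      ∑' q : {q : EuclideanSpace ℝ (Fin 3) // q ∈ Y ∧ q ≠ 0}, lennardJones (dist 0 q.1) ≤ -lam) :
    ¬ LocalCert δ lam ρ := by
  rintro hL
  obtain ⟨Y, u, hu, h0, hsep, hhalf, hrad, htop⟩ := h
  refine hL Y u hu h0 hsep hhalf ?_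
  intro p hp hpρ
  obtain rfl := hrad p hp hpρ
  exact htop

/-- Rung `ρ < 1` at separation `1/4` (from `Negative/DepthZero`): the `21`-point shell at distance `1` binds
the top site at `-7/4` and no other site is within `ρ < 1`. [folklore] -/
theorem not_localCert_quarter {ρ lam : ℝ} (hρ : ρ < 1) (hlam : lam ≤ 7 / 4) : ¬ LocalCert (1 / 4) lam ρ := by
  refine not_localCert_anti le_rfl hlam le_rfl (not_localCert_of_hollowCore ⟨DepthZero.Y, DepthZero.nrm3,
    DepthZero.norm_nrm3, DepthZero.zero_mem_Y, DepthZero.Y_separated, DepthZero.Y_halfSpace, ?_,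
    DepthZero.tsum_top_le⟩)
  intro p hp hpρ
  by_contra hp0
  have h1 := DepthZero.one_le_dist_zero_of_mem_Y hp hp0
  rw [dist_comm] at h1
  linarith

/-- Rung `ρ = 5/4` at separation `23/40` (LANDED `Negative/LocalRadius.lean`, p172796, ACCEPTED): the hollow
core `{0} ∪ 104` grid points refutes `(LOCAL)` at every radius `≤ 5/4` and level parameter `≤ 81/50`. [folklore] -/
theorem rung_five_fourths {ρ lam : ℝ} (hρ : ρ ≤ 5 / 4) (hlam : lam ≤ 81 / 50) : ¬ LocalCert (23 / 40) lam ρ :=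
  LocalRadius.localCert_false_of_radius_le hρ hlam

/-- What the landed rung gives for the stub's own level: `(LOCAL)` needs certificate radius `> 5/4`, i.e. any
`FINCERT` must look beyond the first two coordination shells of the top site. [folklore] -/
theorem stub_needs_radius_gt_five_fourths {ρ : ℝ} (h : LocalCert (23 / 40) (711 / 500) ρ) : 5 / 4 < ρ := by
  by_contra hρ
  exact rung_five_fourths (not_lt.mp hρ) (by norm_num) h

/-- RUNG `13/10` (landed: `Negative/LocalRadius13.lean`, p173276): three relaxed hemispherical shells
(`37 + 71 + 107` points at radii `1.300–1.302 / 1.780–1.883 / 2.325–2.462`, grid `1/1000`) bind the hollow top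
site at `≥ 59/40 = 1.475 > 1.422`; so `(LOCAL)` is false for every certificate radius `≤ 13/10` and every level
`≤ 59/40`. [folklore] -/
theorem rung_thirteen_tenths {ρ lam : ℝ} (hρ : ρ ≤ 13 / 10) (hlam : lam ≤ 59 / 40) :
    ¬ LocalCert (23 / 40) lam ρ :=
  LocalRadius13.localCert_false_of_radius_le_thirteen_tenths hρ hlam

/-- Current certified floor for the stub's own level: `(LOCAL)` needs certificate radius `> 13/10`.
(Numerically the floor is `≥ 1.5` via cup designs, §6 docblock; certification pending.) [folklore] -/
theorem stub_needs_radius_gt_thirteen_tenths {ρ : ℝ} (h : LocalCert (23 / 40) (711 / 500) ρ) :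
    13 / 10 < ρ := by
  by_contra hρ
  exact rung_thirteen_tenths (not_lt.mp hρ) (by norm_num) h

end Summit.AtomisticToContinuum.Crystallization.Cruxes.UniformBindingRigidity.Disproof

end
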